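import Literature.AlgebraicGeometry.Motives.ProjectiveBundleOfQuotientPoints
import HarnessLib

/-!
# `P(G)|_U → U` represents «pairs `(f : T → U, g : T → Gr₁)` with `(f, g) ∈ P(G)(T)`»

Topic `AlgebraicGeometry/Motives`; namespace `Literature.AlgebraicGeometry.Motives.Grassmannian.ProjBundle`. ONE DEFINITION with body
(`liftPoints`, a presheaf of sets on `Scheme`) + a `RepresentableBy` datum (`liftPointsRepresentableBy`) and theorems; no instance,
no notation, no named fact, no `sorry`.

For the incidence subscheme `P(G) ↪ X × Gr₁(M)` (★ `Motives/ProjectiveBundleOfQuotient`) and an open `U ⊆ X`, the open piece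
`proj⁻¹U` of `P(G)` (Mathlib: the open subscheme `↑(proj ⁻¹ᵁ U)` with `proj ∣_ U : ↑(proj⁻¹U) ⟶ ↑U`) REPRESENTS the presheaf
`liftPoints U : T ↦ {(f : T ⟶ U, g : T ⟶ Gr₁(M)) | (f ≫ U ↪ X, g) lifts to P(G)}` — the formal half of the local triviality
«`P(G)|_U ≅ U × ℙʳ`» ([Hartshorne1977, II §7 Prop. 7.11]; [GortzWedhorn2020, (13.8)]): the sequel shows that for `U` trivialising
`G` the product `U × Gr₁(ℤ^{r+1})` represents the SAME presheaf (through ★ `exists_lift_iff`, the kernel form of the lifting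
condition), whence `proj⁻¹U ≅ U × Gr₁(ℤ^{r+1})` over `U` by uniqueness of representing objects (Mathlib
`Functor.RepresentableBy.uniqueUpToIso`).

* `liftPoints U` (functorial by composition); `liftPointsRepresentableBy U : (liftPoints U).RepresentableBy ↑(proj ⁻¹ᵁ U)` —
  `y ↦ (y ≫ proj|_U, y ≫ (proj⁻¹U ↪ P(G)) ≫ toGr)`, inverse by the unique lift through the closed immersion `P(G) ↪ X × Gr` and
  the universal property of the open immersion `proj⁻¹U ↪ P(G)` (Mathlib `IsOpenImmersion.lift`);
* `liftPointsRepresentableBy_homEquiv_fst` — the represented pair has first component `y ≫ proj|_U` (compatibility with the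
  projections to `U`).

## References
* [Hartshorne1977] R. Hartshorne, *Algebraic Geometry* (1977), II §7 Prop. 7.11, Prop. 7.12.
* [GortzWedhorn2020] U. Görtz, T. Wedhorn, *Algebraic Geometry I*, 2nd ed. (2020), (13.8), (8.4); (4.4) (Yoneda, representable functors).
-/

noncomputable section

open CategoryTheory CategoryTheory.Limits Opposite TopologicalSpace AlgebraicGeometry
open Literature.AlgebraicGeometry.Modules

universe u

namespace Literature.AlgebraicGeometry.Motives.Grassmannian

namespace ProjBundle

variable {X : Scheme.{u}} (M : Type u) [AddCommGroup M] {J : Type u} (b : Module.Basis J ℤ M)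
  [(grassmannianSheaf M 1).obj.IsRepresentable] {G : X.Modules} (φ : freeModule X J ⟶ G) (U : X.Opens)

/-- **The presheaf of `U`-points of `P(G)`**: `T ↦ {(f : T ⟶ U, g : T ⟶ Gr₁(M)) | ∃ y : T ⟶ P(G), y ≫ ι = (f ≫ (U ↪ X), g)}`,
functorial by precomposition. [cite: GortzWedhorn2020, (13.8)] -/
def liftPoints : Scheme.{u}ᵒᵖ ⥤ Type u where
  obj T := { q : (unop T ⟶ (U : Scheme.{u})) × (unop T ⟶ grassmannianScheme M 1) //
    ∃ y : unop T ⟶ total M b φ, y ≫ totalι M b φ = prod.lift (q.1 ≫ U.ι) q.2 }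
  map {T T'} h := TypeCat.ofHom fun q => ⟨(h.unop ≫ q.1.1, h.unop ≫ q.1.2), by
    obtain ⟨y, hy⟩ := q.2
    refine ⟨h.unop ≫ y, ?_⟩
    rw [Category.assoc, hy]
    ext <;> simp⟩
  map_id T := ConcreteCategory.hom_ext _ _ fun q => Subtype.ext (by simp)
  map_comp h h' := ConcreteCategory.hom_ext _ _ fun q => Subtype.ext (by simp)

/-- The pair of `U`-point and `Gr`-point of a morphism into the open piece `proj⁻¹U`. [cite: GortzWedhorn2020, (13.8)] -/
theorem exists_lift_of_hom_restrict {T : Scheme.{u}} (y : T ⟶ ((proj M b φ) ⁻¹ᵁ U : (total M b φ).Opens)) :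
    ∃ y' : T ⟶ total M b φ, y' ≫ totalι M b φ =
      prod.lift ((y ≫ (proj M b φ) ∣_ U) ≫ U.ι) (y ≫ ((proj M b φ) ⁻¹ᵁ U).ι ≫ toGr M b φ) := by
  refine ⟨y ≫ ((proj M b φ) ⁻¹ᵁ U).ι, ?_⟩
  ext
  · simp only [Category.assoc, prod.lift_fst, morphismRestrict_ι]
  · simp only [Category.assoc, prod.lift_snd]

/-- **`proj⁻¹U` REPRESENTS `liftPoints U`.** [cite: GortzWedhorn2020, (13.8)] [cite: Hartshorne1977, II §7 Prop. 7.12] -/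
def liftPointsRepresentableBy :
    (liftPoints M b φ U).RepresentableBy (((proj M b φ) ⁻¹ᵁ U : (total M b φ).Opens) : Scheme.{u}) where
  homEquiv {T} :=
    { toFun := fun y => ⟨(y ≫ (proj M b φ) ∣_ U, y ≫ ((proj M b φ) ⁻¹ᵁ U).ι ≫ toGr M b φ),
        exists_lift_of_hom_restrict M b φ U y⟩
      invFun := fun q => IsOpenImmersion.lift ((proj M b φ) ⁻¹ᵁ U).ι q.2.choose (by
        rintro _ ⟨x, rfl⟩
        rw [Scheme.Opens.range_ι]
        change (q.2.choose ≫ proj M b φ) x ∈ U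
        have h : q.2.choose ≫ proj M b φ = q.1.1 ≫ U.ι := by
          have := q.2.choose_spec
          rw [← totalι_fst, ← Category.assoc, this, prod.lift_fst]
        rw [h, Scheme.Hom.comp_apply]
        exact (q.1.1 x).2)
      left_inv := fun y => by
        rw [← cancel_mono ((proj M b φ) ⁻¹ᵁ U).ι, IsOpenImmersion.lift_fac,
          ← cancel_mono (totalι M b φ), (exists_lift_of_hom_restrict M b φ U y).choose_spec]
        ext
        · simp only [Category.assoc, prod.lift_fst, morphismRestrict_ι]
        · simp only [Category.assoc, prod.lift_snd]
      right_inv := fun q => by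
        obtain ⟨⟨f, g⟩, hq⟩ := q
        have hy := hq.choose_spec
        apply Subtype.ext
        apply Prod.ext
        · change IsOpenImmersion.lift _ _ _ ≫ (proj M b φ) ∣_ U = f
          rw [← cancel_mono U.ι, Category.assoc, morphismRestrict_ι, IsOpenImmersion.lift_fac_assoc, ← totalι_fst,
            ← Category.assoc, hy, prod.lift_fst]
        · change IsOpenImmersion.lift _ _ _ ≫ ((proj M b φ) ⁻¹ᵁ U).ι ≫ toGr M b φ = g
          rw [IsOpenImmersion.lift_fac_assoc, ← totalι_snd, ← Category.assoc, hy, prod.lift_snd] }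
  homEquiv_comp {T T'} h y :=
    Subtype.ext (Prod.ext (Category.assoc _ _ _) (Category.assoc _ _ _))

/-- The first component of the represented pair is the projection: `(homEquiv y).1.1 = y ≫ proj|_U`.
[cite: GortzWedhorn2020, (13.8)] -/
theorem liftPointsRepresentableBy_homEquiv_fst {T : Scheme.{u}}
    (y : T ⟶ ((proj M b φ) ⁻¹ᵁ U : (total M b φ).Opens)) :
    ((liftPointsRepresentableBy M b φ U).homEquiv y).1.1 = y ≫ (proj M b φ) ∣_ U := rfl

/-- The second component of the represented pair is the classifying map: `(homEquiv y).1.2 = y ≫ ι' ≫ toGr`.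
[cite: GortzWedhorn2020, (13.8)] -/
theorem liftPointsRepresentableBy_homEquiv_snd {T : Scheme.{u}}
    (y : T ⟶ ((proj M b φ) ⁻¹ᵁ U : (total M b φ).Opens)) :
    ((liftPointsRepresentableBy M b φ U).homEquiv y).1.2 = y ≫ ((proj M b φ) ⁻¹ᵁ U).ι ≫ toGr M b φ := rfl

end ProjBundle

end Literature.AlgebraicGeometry.Motives.Grassmannian

end
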